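import Summits.Ventures.AbcSig.Rows.XTemplateC2a
import Summits.Ventures.AbcSig.Levels.N67
import Summits.Ventures.AbcSig.Levels.N134
import Summits.Ventures.AbcSig.Levels.N67M6X
import Summits.Ventures.AbcSig.Levels.N134M6X
import Summits.Ventures.AbcSig.Levels.N67Q2

/-!
# Venture AbcSig — ROW `C2aL67A6eq`: `xⁿ + 2^a·67^m·yⁿ = z²`, class `a 6` (GENERATED by plean/leanrow.py)

Q-VARIANT (p-lean g6 `gen6/spatch2.py`): same statement shape as `xrow_C2aL67A6eq` plus ONE more named CITED hypothesis `(hQ : M.Q2Package)` (`Recipes/Q2Package.lean`: the cell's q = 2 rule at ODD level, allowed traces {±1, ±3}), in exchange for which the residual pair(s) 67.1 @ 11 — closed in the row of record only by the sieve prime q = 2 (citation-backing audit plean/g5/THETAVERIFY-RECORD.md Part C, class Q2-RULE), previously opaque CITED hypotheses `hX_…` — are discharged IN THE KERNEL (`Levels/N67Q2.lean`: the orbit's eigenvalues including `c₂`, mod-n TreeN certificate against `q2Allowed`) under the COMPUTED hypothesis `hQ2_… : ∀ f, Matches f orbit → Matches f q2`.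
HONEST FRAMING. A row of a COMPUTATION cell (`pub-abcsig`); a CONDITIONAL theorem, no claim on ABC or any summit.
Hypotheses: `BS04Package` (CITED), `DataComplete` at levels [67, 134] (COMPUTED, two-engine certified
level files), `EisPackage` (CITED: [BS04 (3.1), L4.2, Cor 3.1] + [Sturm 1987]) and `Refines` (COMPUTED) for the orbits whose residual exponent is discharged IN THE KERNEL by a module-M6 certificate (`Levels/N…M6X.lean`), and the listed per-orbit exclusions `hX_…` (CITED; the
row's R5 cell names each) that remain. Everything else is kernel-checked (`Rows/XTemplateC2a.lean`, `Levels/N….lean`). Exponent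
range: prime `n ≥ 11`, `n ≠ 67`; `B = 2^a 67^m` with `a, m < n` (n-th-power free).
Row of record:  (sha256 ; SIGNED 2026-08-22T08:50:29Z by referee (ref-g4)); its R0: THEOREM (uses CITED arithmetic facts) for all primes n >= 11 with n coprime to 4288 — class: R-a COMPLETION candidate (closes a printed BS04 Thm 1.3 exception o. Exponents left open by the row of record are excluded here via ; kernel-sieve residuals the row of record closes by a cell module (M6 Eisenstein / M4 Kraus certificates) appear as CITED hypotheses .
-/

namespace Summit.Ventures.AbcSig

/-- Row `C2aL67A6eq` (see module docstring). -/
theorem xrow_C2aL67A6eqQ (M : NewformModel) (hP : M.BS04Package) (hQ : M.Q2Package) (hE : M.EisPackage)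
    (hD67 : M.DataComplete 67 level67Orbits) (hD134 : M.DataComplete 134 level134Orbits)
    (hR_orbit_67_2 : M.Refines 67 orbit_67_2 m6X_67_2) (hR_orbit_134_1 : M.Refines 134 orbit_134_1 m6X_134_1)
    (n : ℕ) (hn : n.Prime) (hmin : 11 ≤ n) (hnℓ : n ≠ 67) (m : ℕ) (hm : 1 ≤ m) (hmn : m < n)
    (hQ2_orbit_67_1 : ∀ f : M.Form 67, M.Matches f orbit_67_1 → M.Matches f q2_67_1)
    (x y z : ℤ) (hxy1 : x * y ≠ 1) (hxy2 : x * y ≠ -1) : ¬ IsPrimitiveSolution 1 (2 ^ 6 * 67 ^ m) 1 n x y z := by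
  have hℓ : Nat.Prime 67 := by norm_num
  have h7 : 7 ≤ n := by omega
  have hS67 :=
    (level67_sieve n hn h7 (fun o => M.Excludes 67 o (famB (2 ^ 6 * 67 ^ m) n (fun _ _ => True)) ∨ M.ExcludesStd 67 o n) (fun hmem => by
      rcases (by simpa using hmem : n = 7 ∨ n = 11) with rfl | rfl
      · omega
      · exact Or.inr (orbit_67_1_exclStdQ2_11 M hQ hQ2_orbit_67_1)) (fun hmem => by
      obtain rfl : n = 11 := by simpa using hmem
      exact Or.inr (m6c_67_2_n11_excludes M hE hR_orbit_67_2)))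
  have hS134 :=
    (level134_sieve n hn h7 (fun o => M.Excludes 134 o (famB (2 ^ 6 * 67 ^ m) n (fun _ _ => True)) ∨ M.ExcludesStd 134 o n) (fun hmem => by
      obtain rfl : n = 17 := by simpa using hmem
      exact Or.inr (m6c_134_1_n17_excludes M hE hR_orbit_134_1)))
  exact xrowC2a_a6 67 hℓ (by norm_num) M hP n hn h7 hnℓ hD67 hD134 m hm hmn
    hS67
    hS134 x y z hxy1 hxy2

end Summit.Ventures.AbcSig
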